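import Mathlib
import Summits.ValiantsHypothesis.ValiantsHypothesis.Theorems.NewtonTauWeak.Negative.Zonogon
import Summits.ValiantsHypothesis.ValiantsHypothesis.Theorems.NewtonUnitEquationsNewtonTauWeakResidueDesignT2
import Summits.ValiantsHypothesis.ValiantsHypothesis.Theorems.NewtonUnitEquationsNewtonTauWeakGradedDesignT2

/-!
# `NewtonUnitEquationsNewtonTauWeakSignLevelSetOfT2` — sign-design kill switch: the binomial T2 bound controls every sign level set over `𝔽₂^r`

Registered stub `stub_signLevelSetOfT2` of line `binomial-normal-form` (crux `NewtonTauWeak`, stmt-ValiantsHypothesis-5904,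
lead c7, namespace `RungC7b` of `Cruxes/NewtonTauWeak/Lines/binomial_normal_form.lean`, STUB P1): the `𝔽₂^r`-twin of the
cyclic T2-instance `stub_cyclicT2Instance` (roots of unity ↦ the `2^r` sign characters of `𝔽₂^r`).

Setting.  A dissociated exponent list `d j ∈ ℕ²` (`j : Fin N`; all subset sums distinct), ARBITRARY labels
`g j ∈ 𝔽₂^r` (here `Fin r → ZMod 2`) and a target `v ∈ 𝔽₂^r`; the *sign level set* is
`X_v = {Σ_{j∈J} d_j : Σ_{j∈J} g_j = v} ⊆ ℕ²`.  The hypothesis `hT2` is the binomial normal form inequality T2 with a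
FIXED exponent `b`: a sum of `K` scalar multiples of products of `N` binomials `1 − ρ_{lj} X^{d_j}` over a common
exponent list has at most `(K N + 2)^b` Newton vertices.

Claim (`stub_signLevelSetOfT2`).  `#ext conv X_v ≤ (2^r N + 2)^b`.

Proof.  Write `σ(z) = [z = 0] − [z ≠ 0] ∈ {±1}` for `z ∈ ZMod 2` and let `χ_l(x) = Π_i σ(l_i x_i)` (`l, x ∈ 𝔽₂^r`) be
the sign bi-character.  Consider the level-ISOLATING sign design with `K = 2^r` products
`f = Σ_l c_l Π_j (1 − χ_l(g_j) X^{d_j})`, `c_l = χ_l(v) / 2^r`, indexed by `l ∈ 𝔽₂^r ≃ Fin (2^r)`.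
* (`SignLevelSetOfT2Aux.sign_add`, `char_add`, `char_sum`)  `σ(a + b) = σ(a) σ(b)` on `ZMod 2`, hence
  `χ_l(x + y) = χ_l(x) χ_l(y)` and `Π_{j∈J} χ_l(g_j) = χ_l(Σ_J g_j)`.
* (`SignLevelSetOfT2Aux.charSum_eq`)  Orthogonality `Σ_l χ_l(x) = 2^r · [x = 0]`: the sum of products factors
  (`Fintype.prod_sum`) as `Π_i Σ_{a ∈ ZMod 2} σ(a x_i) = Π_i (1 + σ(x_i)) = Π_i 2·[x_i = 0]`.
* (`SignLevelSetOfT2Aux.coeff_design`, `coeff_design_subsetSum`)  Expanding every product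
  (`ResidueDesignT2Aux.prod_one_sub_eq_sum`), on a dissociated frame only `T = J` contributes at the subset sum
  `Σ_J d`, so a general design `Σ_l c_l Π_j (1 − ρ_{lj} X^{d_j})` has `coeff_{Σ_J d} = (−1)^{|J|} Σ_l c_l Π_{j∈J} ρ_{lj}`.
* (`SignLevelSetOfT2Aux.coeff_sign_subsetSum`)  For the sign design this is
  `(−1)^{|J|} · 2^{−r} Σ_l χ_l(v + Σ_J g) = (−1)^{|J|} · [v + Σ_J g = 0] = (−1)^{|J|} · [Σ_J g = v]`
  (characteristic `2`: `−v = v`, `ZMod.neg_eq_self_mod_two`).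
* (`SignLevelSetOfT2Aux.support_sign_design`)  Off the subset sums every expanded summand vanishes, so `supp f`
  is EXACTLY the sign level set `X_v`.
* Hence `#ext conv X_v = vert f ≤ (2^r N + 2)^b` by `hT2` (reindexing the `2^r` products by `Fin (2^r)` through
  `Fintype.equivFinOfCardEq`, `Equiv.sum_comp`).

Everything is folklore (character orthogonality on `𝔽₂^r`, expansion of binomial products); no named facts, no
citations, no `def`s.
-/

-- Sub = Summit single-conjunct layout: the duplicated namespace component is mandated by the tree.
set_option linter.dupNamespace false

noncomputable section

open scoped BigOperators
open MvPolynomial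
open Summit.ValiantsHypothesis.ValiantsHypothesis.Theorems.NewtonTauWeak.Negative (vert)

namespace Summit.ValiantsHypothesis.ValiantsHypothesis.Theorems.NewtonUnitEquationsNewtonTauWeak

namespace SignLevelSetOfT2Aux

/-- **The sign `σ(z) = ±1` of `z ∈ ZMod 2` is an additive character**: `σ(a + b) = σ(a) σ(b)` (four cases;
`1 + 1 = 0`). [folklore] -/
theorem sign_add (a b : ZMod 2) :
    (if a + b = 0 then (1 : ℂ) else -1) = (if a = 0 then (1 : ℂ) else -1) * if b = 0 then (1 : ℂ) else -1 := by
  have key : ∀ a b : ZMod 2, a ≠ 0 → b ≠ 0 → a + b = 0 := by decide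
  by_cases ha : a = 0
  · subst ha
    simp
  · by_cases hb : b = 0
    · subst hb
      simp [ha]
    · simp [ha, hb, key a b ha hb]

/-- **Multiplicativity of the sign bi-character** `χ_l(x) = Π_i σ(l_i x_i)` on `𝔽₂^r`:
`χ_l(x + y) = χ_l(x) χ_l(y)` (coordinatewise `sign_add`). [folklore] -/
theorem char_add {r : ℕ} (l x y : Fin r → ZMod 2) :
    (∏ i, if l i * (x + y) i = 0 then (1 : ℂ) else -1) =
      (∏ i, if l i * x i = 0 then (1 : ℂ) else -1) * ∏ i, if l i * y i = 0 then (1 : ℂ) else -1 := by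
  rw [← Finset.prod_mul_distrib]
  refine Finset.prod_congr rfl fun i _ => ?_
  rw [Pi.add_apply, mul_add, sign_add]

/-- The sign bi-character of a finset sum: `Π_{j ∈ J} χ_l(g_j) = χ_l(Σ_{j ∈ J} g_j)` (induction on `J`,
`char_add`). [folklore] -/
theorem char_sum {r N : ℕ} (l : Fin r → ZMod 2) (g : Fin N → Fin r → ZMod 2) (J : Finset (Fin N)) :
    (∏ j ∈ J, ∏ i, if l i * g j i = 0 then (1 : ℂ) else -1) =
      ∏ i, if l i * (∑ j ∈ J, g j) i = 0 then (1 : ℂ) else -1 := by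
  induction J using Finset.induction_on with
  | empty => simp
  | insert j J hj ih => rw [Finset.prod_insert hj, Finset.sum_insert hj, char_add, ih]

/-- **Character orthogonality on `𝔽₂^r`.**  `Σ_l χ_l(x) = 2^r · [x = 0]`: the sum over `l` of the products over
`i` factors as `Π_i Σ_{a ∈ ZMod 2} σ(a x_i) = Π_i (1 + σ(x_i))` (`Fintype.prod_sum`), each factor being `2` if
`x_i = 0` and `0` otherwise. [folklore] -/
theorem charSum_eq {r : ℕ} (x : Fin r → ZMod 2) :
    (∑ l : Fin r → ZMod 2, ∏ i, if l i * x i = 0 then (1 : ℂ) else -1) = if x = 0 then 2 ^ r else 0 := by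
  rw [← Fintype.prod_sum fun i a => if a * x i = 0 then (1 : ℂ) else -1]
  have h2 : ∀ y : ZMod 2, (∑ a : ZMod 2, if a * y = 0 then (1 : ℂ) else -1) = if y = 0 then 2 else 0 := by
    intro y
    have huniv : (Finset.univ : Finset (ZMod 2)) = {0, 1} := rfl
    rw [huniv, Finset.sum_pair (show (0 : ZMod 2) ≠ 1 by decide)]
    by_cases hy : y = 0
    · subst hy
      norm_num
    · have h1 : ¬ ((1 : ZMod 2) * y = 0) := by rwa [one_mul]
      simp only [zero_mul, if_true, if_neg h1, if_neg hy]
      norm_num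
  simp_rw [h2]
  split_ifs with hx
  · subst hx
    simp
  · obtain ⟨i, hi⟩ := Function.ne_iff.mp hx
    exact Finset.prod_eq_zero (Finset.mem_univ i) (if_neg hi)

/-- Coefficients of a general design `Σ_l c_l Π_j (1 − ρ_{lj} X^{d_j})`, raw form: expanding every product
(`ResidueDesignT2Aux.prod_one_sub_eq_sum`), `coeff_e = Σ_l Σ_{T : Σ_T d = e} c_l Π_{j ∈ T} (−ρ_{lj})`. [folklore] -/
theorem coeff_design {ι : Type*} [Fintype ι] {N : ℕ} (c : ι → ℂ) (ρ : ι → Fin N → ℂ)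
    (d : Fin N → (Fin 2 →₀ ℕ)) (e : Fin 2 →₀ ℕ) :
    coeff e (∑ l, C (c l) * ∏ j, (1 - C (ρ l j) * monomial (d j) 1)) =
      ∑ l, ∑ T : Finset (Fin N), if ∑ j ∈ T, d j = e then c l * ∏ j ∈ T, -ρ l j else 0 := by
  rw [coeff_sum]
  refine Finset.sum_congr rfl fun l _ => ?_
  rw [ResidueDesignT2Aux.prod_one_sub_eq_sum, Finset.mul_sum, coeff_sum]
  refine Finset.sum_congr rfl fun T _ => ?_
  rw [C_mul_monomial, coeff_monomial]

/-- **Coefficient formula of a general design on a dissociated frame.**  At the subset sum `Σ_J d` only `T = J`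
contributes, so `coeff_{Σ_J d} = (−1)^{|J|} · Σ_l c_l Π_{j ∈ J} ρ_{lj}` (`Finset.prod_neg`). [folklore] -/
theorem coeff_design_subsetSum {ι : Type*} [Fintype ι] {N : ℕ} (c : ι → ℂ) (ρ : ι → Fin N → ℂ)
    (d : Fin N → (Fin 2 →₀ ℕ))
    (hdis : ∀ J J' : Finset (Fin N), ∑ j ∈ J, d j = ∑ j ∈ J', d j → J = J') (J : Finset (Fin N)) :
    coeff (∑ j ∈ J, d j) (∑ l, C (c l) * ∏ j, (1 - C (ρ l j) * monomial (d j) 1)) =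
      (-1) ^ J.card * ∑ l, c l * ∏ j ∈ J, ρ l j := by
  rw [coeff_design, Finset.mul_sum]
  refine Finset.sum_congr rfl fun l _ => ?_
  rw [Finset.sum_eq_single J (fun T _ hTJ => if_neg fun h => hTJ (hdis T J h))
    (fun h => absurd (Finset.mem_univ J) h), if_pos rfl, Finset.prod_neg, mul_left_comm]

/-- **Coefficient formula of the level-isolating sign design on a dissociated frame.**  With `c_l = χ_l(v) / 2^r`
and `ρ_{lj} = χ_l(g_j)`, multiplicativity (`char_sum`, `char_add`) and orthogonality (`charSum_eq`) give
`coeff_{Σ_J d} f = (−1)^{|J|} · 2^{−r} Σ_l χ_l(v + Σ_J g) = (−1)^{|J|} · [v + Σ_J g = 0] = (−1)^{|J|} · [Σ_J g = v]`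
(characteristic `2`: `−v = v`). [folklore] -/
theorem coeff_sign_subsetSum {N r : ℕ} (g : Fin N → Fin r → ZMod 2) (v : Fin r → ZMod 2)
    (d : Fin N → (Fin 2 →₀ ℕ))
    (hdis : ∀ J J' : Finset (Fin N), ∑ j ∈ J, d j = ∑ j ∈ J', d j → J = J') (J : Finset (Fin N)) :
    coeff (∑ j ∈ J, d j) (∑ l : Fin r → ZMod 2,
        C ((∏ i, if l i * v i = 0 then (1 : ℂ) else -1) / 2 ^ r) *
          ∏ j, (1 - C (∏ i, if l i * g j i = 0 then (1 : ℂ) else -1) * monomial (d j) 1)) =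
      (-1 : ℂ) ^ J.card * if ∑ j ∈ J, g j = v then 1 else 0 := by
  rw [coeff_design_subsetSum _ _ d hdis J]
  congr 1
  have h : ∀ l : Fin r → ZMod 2, (∏ i, if l i * v i = 0 then (1 : ℂ) else -1) / 2 ^ r *
      ∏ j ∈ J, (∏ i, if l i * g j i = 0 then (1 : ℂ) else -1) =
      (∏ i, if l i * (v + ∑ j ∈ J, g j) i = 0 then (1 : ℂ) else -1) / 2 ^ r := by
    intro l
    rw [char_sum, char_add]
    ring
  simp_rw [h]
  rw [← Finset.sum_div, charSum_eq]
  have h2 : (2 : ℂ) ^ r ≠ 0 := pow_ne_zero _ two_ne_zero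
  have hneg : -v = v := funext fun i => ZMod.neg_eq_self_mod_two (v i)
  have hiff : v + ∑ j ∈ J, g j = 0 ↔ ∑ j ∈ J, g j = v := by
    constructor
    · intro h0
      have h1 := eq_neg_of_add_eq_zero_right h0
      rwa [hneg] at h1
    · intro h0
      rw [h0]
      exact funext fun i => CharTwo.add_self_eq_zero (v i)
  by_cases hJ : ∑ j ∈ J, g j = v
  · rw [if_pos hJ, if_pos (hiff.mpr hJ), div_self h2]
  · rw [if_neg hJ, if_neg (mt hiff.mp hJ), zero_div]

/-- **Support of the level-isolating sign design** = the sign level set `{Σ_J d : Σ_J g_j = v}`: off the subset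
sums every raw summand vanishes (`coeff_design`), and at a subset sum the coefficient is `(−1)^{|J|} ≠ 0` times the
level indicator (`coeff_sign_subsetSum`). [folklore] -/
theorem support_sign_design {N r : ℕ} (g : Fin N → Fin r → ZMod 2) (v : Fin r → ZMod 2)
    (d : Fin N → (Fin 2 →₀ ℕ))
    (hdis : ∀ J J' : Finset (Fin N), ∑ j ∈ J, d j = ∑ j ∈ J', d j → J = J') :
    (∑ l : Fin r → ZMod 2,
        C ((∏ i, if l i * v i = 0 then (1 : ℂ) else -1) / 2 ^ r) *
          ∏ j, (1 - C (∏ i, if l i * g j i = 0 then (1 : ℂ) else -1) * monomial (d j) 1)).support =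
      ((Finset.univ.filter fun J : Finset (Fin N) => ∑ j ∈ J, g j = v).image
        fun J => ∑ j ∈ J, d j : Finset (Fin 2 →₀ ℕ)) := by
  have hpow : ∀ J : Finset (Fin N), (-1 : ℂ) ^ J.card ≠ 0 := fun J =>
    pow_ne_zero _ (neg_ne_zero.mpr one_ne_zero)
  ext e
  simp only [mem_support_iff, Finset.mem_image, Finset.mem_filter, Finset.mem_univ, true_and]
  constructor
  · intro he
    by_cases hex : ∃ J : Finset (Fin N), ∑ j ∈ J, d j = e
    · obtain ⟨J, rfl⟩ := hex
      rw [coeff_sign_subsetSum g v d hdis J] at he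
      refine ⟨J, ?_, rfl⟩
      by_contra hJ
      exact he (by rw [if_neg hJ, mul_zero])
    · refine absurd ?_ he
      rw [coeff_design]
      exact Finset.sum_eq_zero fun l _ => Finset.sum_eq_zero fun T _ => if_neg fun hT => hex ⟨T, hT⟩
  · rintro ⟨J, hJ, rfl⟩
    rw [coeff_sign_subsetSum g v d hdis J, if_pos hJ, mul_one]
    exact hpow J

end SignLevelSetOfT2Aux

/-- **The sign-design kill switch (the `𝔽₂^r`-twin of the level-set reduction).**  If the binomial normal form
inequality T2 holds with exponent `b` — every sum of `K` scalar multiples of products of `N` binomials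
`1 − ρ_{lj} X^{d_j}` over a common exponent list has at most `(K N + 2)^b` Newton vertices — then on a dissociated
exponent list `d` every sign level set `X_v = {Σ_J d_j : Σ_{j∈J} g_j = v}` of arbitrary labels `g_j ∈ 𝔽₂^r`
(`Fin r → ZMod 2`) has at most `(2^r N + 2)^b` hull vertices.  Proof: the level-isolating sign design
`Σ_{l ∈ 𝔽₂^r} χ_l(v)/2^r · Π_j (1 − χ_l(g_j) X^{d_j})` (`K = 2^r` products, reindexed by `Fin (2^r)` through
`Fintype.equivFinOfCardEq`) has coefficient `±[Σ_J g_j = v]` at `Σ_J d_j` by character orthogonality, hence support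
exactly `X_v`, and `hT2` bounds its vertex count. [folklore] -/
theorem stub_signLevelSetOfT2 (b : ℕ)
    (hT2 : ∀ (K N : ℕ) (c : Fin K → ℂ) (ρ : Fin K → Fin N → ℂ) (d : Fin N → (Fin 2 →₀ ℕ)),
      vert (∑ l, C (c l) * ∏ j, (1 - C (ρ l j) * monomial (d j) 1)) ≤ (K * N + 2) ^ b)
    (N r : ℕ) (g : Fin N → Fin r → ZMod 2) (v : Fin r → ZMod 2) (d : Fin N → (Fin 2 →₀ ℕ))
    (hdis : ∀ J J' : Finset (Fin N), ∑ j ∈ J, d j = ∑ j ∈ J', d j → J = J') :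
    (Set.extremePoints ℝ (convexHull ℝ ((fun e : Fin 2 →₀ ℕ => fun i : Fin 2 => ((e i : ℕ) : ℝ)) ''
      (((Finset.univ.filter fun J : Finset (Fin N) => ∑ j ∈ J, g j = v).image
        fun J => ∑ j ∈ J, d j : Finset (Fin 2 →₀ ℕ)) : Set (Fin 2 →₀ ℕ))))).ncard ≤
      (2 ^ r * N + 2) ^ b := by
  -- `𝔽₂^r` has `2^r` elements: reindex the products of the sign design by `Fin (2^r)`.
  have hcard : Fintype.card (Fin r → ZMod 2) = 2 ^ r := by
    rw [Fintype.card_fun, ZMod.card, Fintype.card_fin]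
  obtain ⟨e⟩ : Nonempty (Fin (2 ^ r) ≃ (Fin r → ZMod 2)) := ⟨(Fintype.equivFinOfCardEq hcard).symm⟩
  -- T2 for the level-isolating sign design (`K = 2^r` products), whose support is exactly `X_v`.
  have key : vert (∑ l : Fin r → ZMod 2,
      C ((∏ i, if l i * v i = 0 then (1 : ℂ) else -1) / 2 ^ r) *
        ∏ j, (1 - C (∏ i, if l i * g j i = 0 then (1 : ℂ) else -1) * monomial (d j) 1)) ≤
      (2 ^ r * N + 2) ^ b := by
    rw [← Equiv.sum_comp e]
    exact hT2 (2 ^ r) N (fun k => (∏ i, if e k i * v i = 0 then (1 : ℂ) else -1) / 2 ^ r)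
      (fun k j => ∏ i, if e k i * g j i = 0 then (1 : ℂ) else -1) d
  unfold vert at key
  rwa [SignLevelSetOfT2Aux.support_sign_design g v d hdis] at key

end Summit.ValiantsHypothesis.ValiantsHypothesis.Theorems.NewtonUnitEquationsNewtonTauWeak

end
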